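import Summits.Ventures.YMGap.Thresholds.HaarThirdMomentSU3
import HarnessLib

/-!
# The Haar THIRD moments of `SU(3)`, II: `∫ (tr U)³ dU = 1`, `∫ (tr U)² tr Ū dU = 0`, `∫ (Re tr U)³ dU = 1/4`
# (row type C-PRESS, endpoint `β = 0`, part 14b)

Cell `pub-ymgap`, seat ds-1 (gen 11). HONEST FRAMING: pure compact-group integration for a compact group `G ≅ SU(3)`
(`IsSpecialUnitaryModel ρ`); nothing lattice-specific, nothing about the continuum or the Clay problem. Kernel theorems only,
0 compute, no definitions. From part 14a (`integral_diag3`: `∫ U_{ii}U_{jj}U_{kk} = 1/6` exactly on permutation patterns;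
`integral_entry_entry_conj_entry`: every `∫ U U Ū` vanishes): ★ `integral_trace_pow_three : ∫ (tr ρ(g))³ dg = 1` (the determinant is
the only cubic invariant of the fundamental representation), ★ `integral_trace_sq_mul_conj_trace : ∫ (tr ρ(g))² conj(tr ρ(g)) dg = 0`
(no invariant in `V ⊗ V ⊗ V̄`), hence ★★ `integral_reTr_pow_three : ∫ (Re tr ρ(g))³ dg = 1/4` via
`(Re z)³ = (Re z³ + 3 Re(z² z̄))/4`, and `integral_third_reTr_pow_three : ∫ ((1/3) Re tr)³ = 1/108` — THE THIRD CUMULANT OF THE `SU(3)`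
PLAQUETTE VARIABLE under Haar measure is `1/108 ≠ 0` (its mean vanishes; for `SU(2)` the third moment is `0`, part 10): the
strong-coupling series of `SU(3)` lattice gauge theory carries a cubic (baryon/determinant) vertex absent for `SU(2)`; indeed for
EVERY `N ≠ 3` the third character moment vanishes by the centre twist alone (`integral_reTr_pow_three_eq_zero`, `N ≥ 2`, `N ≠ 3`). Concrete
`Matrix.specialUnitaryGroup (Fin 3) ℂ` versions at the end. References: M. Creutz, *Quarks, gluons and lattices* (1983) §8;
Balian–Drouffe–Itzykson, Phys. Rev. D 11 (1975) 2104 §III. Everything here is proved. [folklore]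
-/

noncomputable section

open MeasureTheory Complex
open Literature.MathematicalPhysics.QuantumLattice Literature.MathematicalPhysics.QuantumFieldTheory

namespace Summit.Ventures.YMGap.HaarThirdMomentSU3

section Model

variable {G : Type*} [Group G] [TopologicalSpace G] [IsTopologicalGroup G] [CompactSpace G]
  [MeasurableSpace G] [BorelSpace G] (ρ : G →* Matrix (Fin 3) (Fin 3) ℂ)

/-! ### The cubic moments of the character -/

/-- `(tr M)³ = Σ_{i,j,k} M_{ii} M_{jj} M_{kk}` for a `3 × 3` matrix. [folklore] -/
theorem trace_pow_three (M : Matrix (Fin 3) (Fin 3) ℂ) :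
    M.trace ^ 3 = ∑ i : Fin 3, ∑ j : Fin 3, ∑ k : Fin 3, M i i * M j j * M k k := by
  rw [Matrix.trace_fin_three]
  simp only [Fin.sum_univ_three]
  ring

/-- ★ **`∫ (tr ρ(g))³ dg = 1` for `G ≅ SU(3)`**: the only cubic invariant of the fundamental representation is the determinant.
[folklore] -/
theorem integral_trace_pow_three (hρ : IsSpecialUnitaryModel ρ) :
    ∫ g, (ρ g).trace ^ 3 ∂haarProbability G = 1 := by
  have hI : ∀ i j k : Fin 3, Integrable (fun g => ρ g i i * ρ g j j * ρ g k k) (haarProbability G) :=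
    fun i j k => integrable_entry3 ρ hρ.1 i j k i j k
  simp_rw [trace_pow_three]
  rw [integral_finsetSum _ (fun i _ => integrable_finsetSum _ (fun j _ => integrable_finsetSum _ (fun k _ => hI i j k)))]
  simp_rw [integral_finsetSum _ (fun j _ => integrable_finsetSum _ (fun k _ => hI _ j k)),
    integral_finsetSum _ (fun k _ => hI _ _ k), integral_diag3 ρ hρ]
  simp [Fin.sum_univ_three]
  norm_num

/-- `(tr M)² · conj(tr M) = Σ_{i,j,k} M_{ii} M_{jj} conj(M_{kk})`. [folklore] -/
theorem trace_sq_mul_conj_trace (M : Matrix (Fin 3) (Fin 3) ℂ) :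
    M.trace ^ 2 * (starRingEnd ℂ) M.trace = ∑ i : Fin 3, ∑ j : Fin 3, ∑ k : Fin 3, M i i * M j j * (starRingEnd ℂ) (M k k) := by
  rw [Matrix.trace_fin_three]
  simp only [Fin.sum_univ_three, map_add]
  ring

/-- ★ **`∫ (tr ρ(g))² conj(tr ρ(g)) dg = 0` for `G ≅ SU(3)`** (no invariant in `V ⊗ V ⊗ V̄`). [folklore] -/
theorem integral_trace_sq_mul_conj_trace (hρ : IsSpecialUnitaryModel ρ) :
    ∫ g, (ρ g).trace ^ 2 * (starRingEnd ℂ) (ρ g).trace ∂haarProbability G = 0 := by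
  have hI : ∀ i j k : Fin 3, Integrable (fun g => ρ g i i * ρ g j j * (starRingEnd ℂ) (ρ g k k)) (haarProbability G) :=
    fun i j k => (((hρ.1.matrix_elem i i).mul (hρ.1.matrix_elem j j)).mul
      (Complex.continuous_conj.comp (hρ.1.matrix_elem k k))).integrable_of_hasCompactSupport
        (HasCompactSupport.of_compactSpace _)
  simp_rw [trace_sq_mul_conj_trace]
  rw [integral_finsetSum _ (fun i _ => integrable_finsetSum _ (fun j _ => integrable_finsetSum _ (fun k _ => hI i j k)))]
  simp_rw [integral_finsetSum _ (fun j _ => integrable_finsetSum _ (fun k _ => hI _ j k)),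
    integral_finsetSum _ (fun k _ => hI _ _ k), integral_entry_entry_conj_entry ρ hρ]
  simp

/-- The pointwise identity `(Re z)³ = (Re(z³) + 3 Re(z² z̄))/4`. [folklore] -/
theorem re_pow_three_eq (z : ℂ) : z.re ^ 3 = ((z ^ 3).re + 3 * (z ^ 2 * (starRingEnd ℂ) z).re) / 4 := by
  have hz : (starRingEnd ℂ) z = ⟨z.re, -z.im⟩ := rfl
  rw [hz]
  simp only [pow_succ, pow_zero, one_mul, Complex.mul_re, Complex.mul_im]
  ring

/-- ★★ **THE HAAR THIRD MOMENT OF THE `SU(3)` CHARACTER: `∫ (Re tr ρ(g))³ dg = 1/4`** for every compact group `G ≅ SU(3)`;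
hence the third cumulant of the plaquette variable `W = (1/3) Re tr U` under Haar measure is `1/108` (its mean vanishes,
`integral_reTr_eq_zero`). [folklore] -/
theorem integral_reTr_pow_three (hρ : IsSpecialUnitaryModel ρ) :
    ∫ g, PlaquetteLowerBound.reTr ρ g ^ 3 ∂haarProbability G = 1 / 4 := by
  unfold PlaquetteLowerBound.reTr
  simp_rw [re_pow_three_eq]
  have hc : Continuous fun g : G => (ρ g).trace := hρ.1.matrix_trace
  have hi3c : Integrable (fun g : G => (ρ g).trace ^ 3) (haarProbability G) :=
    (hc.pow 3).integrable_of_hasCompactSupport (HasCompactSupport.of_compactSpace _)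
  have hi21c : Integrable (fun g : G => (ρ g).trace ^ 2 * (starRingEnd ℂ) (ρ g).trace) (haarProbability G) :=
    ((hc.pow 2).mul (Complex.continuous_conj.comp hc)).integrable_of_hasCompactSupport (HasCompactSupport.of_compactSpace _)
  have hi3 : Integrable (fun g : G => ((ρ g).trace ^ 3).re) (haarProbability G) := hi3c.re
  have hi21 : Integrable (fun g : G => 3 * ((ρ g).trace ^ 2 * (starRingEnd ℂ) (ρ g).trace).re) (haarProbability G) :=
    hi21c.re.const_mul 3
  rw [integral_div, integral_add hi3 hi21, integral_const_mul]
  have e3 : ∫ g, ((ρ g).trace ^ 3).re ∂haarProbability G = 1 := by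
    have h := integral_re hi3c
    rw [integral_trace_pow_three ρ hρ] at h
    simpa using h
  have e21 : ∫ g, ((ρ g).trace ^ 2 * (starRingEnd ℂ) (ρ g).trace).re ∂haarProbability G = 0 := by
    have h := integral_re hi21c
    rw [integral_trace_sq_mul_conj_trace ρ hρ] at h
    simpa using h
  rw [e3, e21]
  norm_num

/-- **`∫ ((1/3) Re tr ρ(g))³ dg = 1/108`**: the third moment (= third cumulant) of the `SU(3)` plaquette variable under Haar
measure. [folklore] -/
theorem integral_third_reTr_pow_three (hρ : IsSpecialUnitaryModel ρ) :
    ∫ g, ((3 : ℝ)⁻¹ * PlaquetteLowerBound.reTr ρ g) ^ 3 ∂haarProbability G = 1 / 108 := by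
  simp_rw [mul_pow]
  rw [integral_const_mul, integral_reTr_pow_three ρ hρ]
  norm_num

end Model

/-! ### Every `SU(N)` with `N ≠ 3`: the third moment of the character VANISHES (centre twist) -/

section CentreTwist

variable {N : ℕ} {G : Type*} [Group G] [TopologicalSpace G] [IsTopologicalGroup G] [CompactSpace G]
  [MeasurableSpace G] [BorelSpace G] (ρ : G →* Matrix (Fin N) (Fin N) ℂ)

/-- **`∫ (tr ρ(g))³ dg = 0` for `G ≅ SU(N)`, `N ≥ 2`, `N ≠ 3`** (centre twist: `tr ρ(zg) = ζ tr ρ(g)` with `ζ = e^{2πi/N}`, and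
`ζ³ ≠ 1` because `N ∤ 3`). [folklore] -/
theorem integral_trace_pow_three_eq_zero (hρ : IsSpecialUnitaryModel ρ) (hN : 2 ≤ N) (hN3 : N ≠ 3) :
    ∫ g, (ρ g).trace ^ 3 ∂haarProbability G = 0 := by
  set ζ : ℂ := Complex.exp (2 * Real.pi * Complex.I / N) with hζdef
  have hN0 : N ≠ 0 := by omega
  have hprim : IsPrimitiveRoot ζ N := Complex.isPrimitiveRoot_exp N hN0
  have hζ3 : ζ ^ 3 ≠ 1 := fun h => by
    have hdvd : N ∣ 3 := (hprim.pow_eq_one_iff_dvd 3).mp h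
    have hle : N ≤ 3 := Nat.le_of_dvd (by norm_num) hdvd
    interval_cases N <;> simp_all
  have hmem : ζ • (1 : Matrix (Fin N) (Fin N) ℂ) ∈ Matrix.specialUnitaryGroup (Fin N) ℂ := by
    rw [hζdef]; exact RobustBall.HaarSecondMoments.smul_one_mem (N := N) hN0
  have h := RobustBall.HaarSecondMoments.integral_comp_mul_left ρ hρ hmem (fun M => M.trace ^ 3)
  have ht : ∀ M : Matrix (Fin N) (Fin N) ℂ, (ζ • (1 : Matrix (Fin N) (Fin N) ℂ) * M).trace ^ 3 =
      ζ ^ 3 * M.trace ^ 3 := fun M => by rw [smul_mul_assoc, one_mul, Matrix.trace_smul, smul_eq_mul, mul_pow]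
  simp only [ht] at h
  rw [integral_const_mul] at h
  exact eq_zero_of_mul_eq_self hζ3 h

/-- **`∫ (tr ρ(g))² conj(tr ρ(g)) dg = 0` for `G ≅ SU(N)`, `N ≥ 2`** (centre twist: the integrand picks up `ζ² ζ̄ = ζ ≠ 1`).
[folklore] -/
theorem integral_trace_sq_mul_conj_trace_eq_zero (hρ : IsSpecialUnitaryModel ρ) (hN : 2 ≤ N) :
    ∫ g, (ρ g).trace ^ 2 * (starRingEnd ℂ) (ρ g).trace ∂haarProbability G = 0 := by
  set ζ : ℂ := Complex.exp (2 * Real.pi * Complex.I / N) with hζdef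
  have hN0 : N ≠ 0 := by omega
  have hprim : IsPrimitiveRoot ζ N := Complex.isPrimitiveRoot_exp N hN0
  have hζ1 : ζ ≠ 1 := fun h => by
    have hdvd : N ∣ 1 := (hprim.pow_eq_one_iff_dvd 1).mp (by rw [pow_one, h])
    have := Nat.le_of_dvd one_pos hdvd
    omega
  have hnorm : ‖ζ‖ = 1 := hprim.norm'_eq_one hN0
  have hconj : ζ * (starRingEnd ℂ) ζ = 1 := by
    rw [Complex.mul_conj, Complex.normSq_eq_norm_sq, hnorm]; simp
  have hmem : ζ • (1 : Matrix (Fin N) (Fin N) ℂ) ∈ Matrix.specialUnitaryGroup (Fin N) ℂ := by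
    rw [hζdef]; exact RobustBall.HaarSecondMoments.smul_one_mem (N := N) hN0
  have h := RobustBall.HaarSecondMoments.integral_comp_mul_left ρ hρ hmem
    (fun M => M.trace ^ 2 * (starRingEnd ℂ) M.trace)
  have ht : ∀ M : Matrix (Fin N) (Fin N) ℂ, (ζ • (1 : Matrix (Fin N) (Fin N) ℂ) * M).trace ^ 2 *
      (starRingEnd ℂ) (ζ • (1 : Matrix (Fin N) (Fin N) ℂ) * M).trace = ζ * (M.trace ^ 2 * (starRingEnd ℂ) M.trace) := by
    intro M
    rw [smul_mul_assoc, one_mul, Matrix.trace_smul, smul_eq_mul, mul_pow, map_mul]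
    linear_combination (ζ * M.trace ^ 2 * (starRingEnd ℂ) M.trace) * hconj
  simp only [ht] at h
  rw [integral_const_mul] at h
  exact eq_zero_of_mul_eq_self hζ1 h

/-- ★★ **THE THIRD MOMENT OF THE `SU(N)` CHARACTER VANISHES FOR EVERY `N ≠ 3`**: `∫ (Re tr ρ(g))³ dg = 0` for `G ≅ SU(N)`,
`N ≥ 2`, `N ≠ 3` — by the centre alone; together with `integral_reTr_pow_three` (`= 1/4` for `N = 3`) this is the dichotomy: among all
`SU(N)` only `SU(3)` has a cubic strong-coupling vertex at the one-plaquette level. [folklore] -/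
theorem integral_reTr_pow_three_eq_zero (hρ : IsSpecialUnitaryModel ρ) (hN : 2 ≤ N) (hN3 : N ≠ 3) :
    ∫ g, PlaquetteLowerBound.reTr ρ g ^ 3 ∂haarProbability G = 0 := by
  unfold PlaquetteLowerBound.reTr
  simp_rw [re_pow_three_eq]
  have hc : Continuous fun g : G => (ρ g).trace := hρ.1.matrix_trace
  have hi3c : Integrable (fun g : G => (ρ g).trace ^ 3) (haarProbability G) :=
    (hc.pow 3).integrable_of_hasCompactSupport (HasCompactSupport.of_compactSpace _)
  have hi21c : Integrable (fun g : G => (ρ g).trace ^ 2 * (starRingEnd ℂ) (ρ g).trace) (haarProbability G) :=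
    ((hc.pow 2).mul (Complex.continuous_conj.comp hc)).integrable_of_hasCompactSupport (HasCompactSupport.of_compactSpace _)
  have hi3 : Integrable (fun g : G => ((ρ g).trace ^ 3).re) (haarProbability G) := hi3c.re
  have hi21 : Integrable (fun g : G => 3 * ((ρ g).trace ^ 2 * (starRingEnd ℂ) (ρ g).trace).re) (haarProbability G) :=
    hi21c.re.const_mul 3
  rw [integral_div, integral_add hi3 hi21, integral_const_mul]
  have e3 : ∫ g, ((ρ g).trace ^ 3).re ∂haarProbability G = 0 := by
    have h := integral_re hi3c
    rw [integral_trace_pow_three_eq_zero ρ hρ hN hN3] at h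
    simpa using h
  have e21 : ∫ g, ((ρ g).trace ^ 2 * (starRingEnd ℂ) (ρ g).trace).re ∂haarProbability G = 0 := by
    have h := integral_re hi21c
    rw [integral_trace_sq_mul_conj_trace_eq_zero ρ hρ hN] at h
    simpa using h
  rw [e3, e21]
  norm_num

end CentreTwist

/-! ### The concrete group `SU(3) = Matrix.specialUnitaryGroup (Fin 3) ℂ` -/

/-- ★★ **`∫_{SU(3)} U₀₀ U₁₁ U₂₂ dU = 1/6`** (the baryon vertex normalisation). [folklore] -/
theorem integral_baryon_su3 :
    ∫ U, (U : Matrix (Fin 3) (Fin 3) ℂ) 0 0 * (U : Matrix (Fin 3) (Fin 3) ℂ) 1 1 * (U : Matrix (Fin 3) (Fin 3) ℂ) 2 2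
      ∂haarProbability (Matrix.specialUnitaryGroup (Fin 3) ℂ) = 1 / 6 := by
  have h := integral_baryon (fundamentalRep (Fin 3)) (TorusAreaLaw.isSpecialUnitaryModel_fundamentalRep 3)
  simpa only [fundamentalRep_apply] using h

/-- ★ **`∫_{SU(3)} (tr U)³ dU = 1`.** [folklore] -/
theorem integral_trace_pow_three_su3 :
    ∫ U, (U : Matrix (Fin 3) (Fin 3) ℂ).trace ^ 3 ∂haarProbability (Matrix.specialUnitaryGroup (Fin 3) ℂ) = 1 := by
  have h := integral_trace_pow_three (fundamentalRep (Fin 3)) (TorusAreaLaw.isSpecialUnitaryModel_fundamentalRep 3)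
  simpa only [fundamentalRep_apply] using h

/-- ★★ **`∫_{SU(3)} (Re tr U)³ dU = 1/4`.** [folklore] -/
theorem integral_reTr_pow_three_su3 :
    ∫ U, ((U : Matrix (Fin 3) (Fin 3) ℂ).trace.re) ^ 3 ∂haarProbability (Matrix.specialUnitaryGroup (Fin 3) ℂ) = 1 / 4 := by
  have h := integral_reTr_pow_three (fundamentalRep (Fin 3)) (TorusAreaLaw.isSpecialUnitaryModel_fundamentalRep 3)
  simpa only [PlaquetteLowerBound.reTr, fundamentalRep_apply] using h

end Summit.Ventures.YMGap.HaarThirdMomentSU3
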